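import Mathlib
import Summits.AnomalousDissipation.AnomalousDissipation.Theorems.SoloBlindTailOperator

/-!
# SoloBlind — seed glue: the engine's dominance test, seed radius, seed Lipschitz constant and the monotonicity of `|β_k|`

Corollaries of `SoloBlindTailOperator` in exactly the form ENGINE L v1.2l `tail_ball` / `tail_lip_rec` uses them:

* `dominant_of_bounds` — uniform bounds `b ≤ ‖β j‖`, `‖a j‖ ≤ amax`, `‖c j‖ ≤ cmax`, `amax + cmax < b` give
  `Dominant a β c b ((amax+cmax)/b)`;
* `seed_radius` — then `‖tval‖ ≤ amax/(b - amax - cmax)`;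
* `seed_lipschitz` — for the shifted diagonal `β + μ`, `‖μ‖ ≤ s`, `amax + cmax < b - s`:
  `‖tval(β) - tval(β+μ)‖ ≤ amax · s/(b - s - amax - cmax)²` (`lip0`);
* `norm_betaRow_mono` — for rows `β_k = w + i γ (k² - 1/2)` (`γ ≥ 0`, `w` fixed: the chains of LEMMA P at fixed `x, g, κ`),
  `Im β_{k₀} ≥ 0` implies `‖β_{k₀}‖ ≤ ‖β_k‖` for all `k ≥ k₀` — so the infimum of `|β|` over the whole tail is attained at its
  first row, which is what the engine bounds (its `im_lo ≥ 0` test).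
-/

namespace Summit.AnomalousDissipation.SoloBlind.TailSeedGlue

open Summit.AnomalousDissipation.SoloBlind.TailOperator

variable {a β c : ℕ → ℂ} {b amax cmax : ℝ}

/-- The engine's dominance test packaged as a `Dominant` structure with `q = (amax + cmax)/b`. -/
theorem dominant_of_bounds (hb : ∀ j, b ≤ ‖β j‖) (ha : ∀ j, ‖a j‖ ≤ amax) (hc : ∀ j, ‖c j‖ ≤ cmax)
    (ha0 : 0 ≤ amax) (hc0 : 0 ≤ cmax) (hdom : amax + cmax < b) :
    Dominant a β c b ((amax + cmax) / b) := by
  have hb0 : 0 < b := lt_of_le_of_lt (add_nonneg ha0 hc0) hdom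
  refine ⟨hb0, div_nonneg (add_nonneg ha0 hc0) hb0.le, (div_lt_one hb0).mpr hdom, hb, fun j => ?_⟩
  calc ‖a j‖ + ‖c j‖ ≤ amax + cmax := add_le_add (ha j) (hc j)
    _ = (amax + cmax) / b * b := by field_simp
    _ ≤ (amax + cmax) / b * ‖β j‖ :=
        mul_le_mul_of_nonneg_left (hb j) (div_nonneg (add_nonneg ha0 hc0) hb0.le)

/-- `b (1 - (amax+cmax)/b) = b - amax - cmax`. -/
theorem b_mul_one_sub (hb0 : b ≠ 0) : b * (1 - (amax + cmax) / b) = b - amax - cmax := by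
  field_simp; ring

/-- SEED RADIUS in engine form: `‖t‖ ≤ amax/(b - amax - cmax)`. -/
theorem seed_radius (hb : ∀ j, b ≤ ‖β j‖) (ha : ∀ j, ‖a j‖ ≤ amax) (hc : ∀ j, ‖c j‖ ≤ cmax)
    (ha0 : 0 ≤ amax) (hc0 : 0 ≤ cmax) (hdom : amax + cmax < b) :
    ‖tval (dominant_of_bounds hb ha hc ha0 hc0 hdom)‖ ≤ amax / (b - amax - cmax) := by
  have hD := dominant_of_bounds hb ha hc ha0 hc0 hdom
  have hb0 : 0 < b := hD.b_pos
  have hm : 0 < b - amax - cmax := by linarith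
  have h := norm_tval_le hD
  have e : 1 / b / (1 - (amax + cmax) / b) = 1 / (b - amax - cmax) := by
    rw [div_div, b_mul_one_sub hb0.ne']
  rw [e] at h
  calc ‖tval hD‖ ≤ ‖a 0‖ * (1 / (b - amax - cmax)) := h
    _ ≤ amax * (1 / (b - amax - cmax)) := mul_le_mul_of_nonneg_right (ha 0) (by positivity)
    _ = amax / (b - amax - cmax) := by ring

/-- SEED LIPSCHITZ CONSTANT in engine form: for the shifted diagonal `β + μ`, `‖μ‖ ≤ s`, with `amax + cmax < b - s`,
`‖t(β) - t(β+μ)‖ ≤ amax · s / (b - s - amax - cmax)²` — `lip0 = amax/(b - s - amax - cmax)²`. Both systems are taken with the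
common constants `(b - s, (amax+cmax)/(b - s))`. -/
theorem seed_lipschitz (hb : ∀ j, b ≤ ‖β j‖) (ha : ∀ j, ‖a j‖ ≤ amax) (hc : ∀ j, ‖c j‖ ≤ cmax)
    (ha0 : 0 ≤ amax) (hc0 : 0 ≤ cmax) {μ : ℂ} {s : ℝ} (hs0 : 0 ≤ s) (hμ : ‖μ‖ ≤ s) (hdom : amax + cmax < b - s) :
    ∃ (hD : Dominant a β c (b - s) ((amax + cmax) / (b - s)))
      (hD' : Dominant a (fun j => β j + μ) c (b - s) ((amax + cmax) / (b - s))),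
      ‖tval hD - tval hD'‖ ≤ amax * (s / (b - s - amax - cmax) ^ 2) := by
  have hb' : ∀ j, b - s ≤ ‖β j‖ := fun j => by linarith [hb j]
  have hb'' : ∀ j, b - s ≤ ‖β j + μ‖ := fun j => by
    have := norm_sub_norm_le (β j) (-μ)
    rw [sub_neg_eq_add, norm_neg] at this
    linarith [hb j]
  have hD := dominant_of_bounds hb' ha hc ha0 hc0 hdom
  have hD' := dominant_of_bounds (β := fun j => β j + μ) hb'' ha hc ha0 hc0 hdom
  refine ⟨hD, hD', ?_⟩
  have hbs : 0 < b - s := hD.b_pos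
  have hm : 0 < b - s - amax - cmax := by linarith
  have h := norm_tval_sub_le hD hD' hs0 (fun j => by simp [hμ])
  have e : 1 / (b - s) / (1 - (amax + cmax) / (b - s)) = 1 / (b - s - amax - cmax) := by
    rw [div_div, b_mul_one_sub hbs.ne']
  rw [e] at h
  calc ‖tval hD - tval hD'‖ ≤ ‖a 0‖ * (s * (1 / (b - s - amax - cmax)) * (1 / (b - s - amax - cmax))) := h
    _ ≤ amax * (s * (1 / (b - s - amax - cmax)) * (1 / (b - s - amax - cmax))) :=
        mul_le_mul_of_nonneg_right (ha 0) (by positivity)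
    _ = amax * (s / (b - s - amax - cmax) ^ 2) := by field_simp

/-- The `k`-dependent imaginary part `γ (k² - 1/2)` of the rows of the LEMMA-P chains at fixed `(x, g, κ)` (`γ = g⁴`). -/
noncomputable def rowIm (γ : ℝ) (k : ℕ) : ℝ := γ * ((k : ℝ) ^ 2 - 1 / 2)

/-- The rows `β_k = w + i · rowIm γ k`. -/
noncomputable def betaRow (w : ℂ) (γ : ℝ) (k : ℕ) : ℂ := w + Complex.I * (rowIm γ k : ℂ)

/-- Real part of `betaRow` is `k`-independent. -/
theorem betaRow_re (w : ℂ) (γ : ℝ) (k : ℕ) : (betaRow w γ k).re = w.re := by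
  simp only [betaRow, Complex.add_re, Complex.mul_re, Complex.I_re, Complex.I_im, Complex.ofReal_re,
    Complex.ofReal_im, zero_mul, mul_zero, sub_zero, add_zero]

/-- Imaginary part of `betaRow`. -/
theorem betaRow_im (w : ℂ) (γ : ℝ) (k : ℕ) : (betaRow w γ k).im = w.im + γ * ((k : ℝ) ^ 2 - 1 / 2) := by
  simp only [betaRow, rowIm, Complex.add_im, Complex.mul_im, Complex.I_re, Complex.I_im, Complex.ofReal_re,
    Complex.ofReal_im, one_mul, mul_zero, zero_add]

/-- The imaginary part of `betaRow` is nondecreasing in `k` (`γ ≥ 0`). -/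
theorem betaRow_im_mono (w : ℂ) {γ : ℝ} (hγ : 0 ≤ γ) {k₀ k : ℕ} (hk : k₀ ≤ k) :
    (betaRow w γ k₀).im ≤ (betaRow w γ k).im := by
  rw [betaRow_im, betaRow_im]
  have : ((k₀ : ℝ)) ^ 2 ≤ ((k : ℝ)) ^ 2 := by
    have h0 : (0 : ℝ) ≤ k₀ := Nat.cast_nonneg _
    have h1 : (k₀ : ℝ) ≤ k := by exact_mod_cast hk
    nlinarith
  nlinarith

/-- MONOTONICITY OF `|β_k|`: if `Im β_{k₀} ≥ 0` then `‖β_{k₀}‖ ≤ ‖β_k‖` for every `k ≥ k₀` — the infimum of `|β|` over the tail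
`k ≥ k₀` is `|β_{k₀}|` (engine v1.2l `im_lo ≥ 0` test). -/
theorem norm_betaRow_mono (w : ℂ) {γ : ℝ} (hγ : 0 ≤ γ) {k₀ k : ℕ} (hk : k₀ ≤ k) (him : 0 ≤ (betaRow w γ k₀).im) :
    ‖betaRow w γ k₀‖ ≤ ‖betaRow w γ k‖ := by
  have hre : (betaRow w γ k₀).re = (betaRow w γ k).re := by rw [betaRow_re, betaRow_re]
  have him' := betaRow_im_mono w hγ hk
  have hsq : ‖betaRow w γ k₀‖ ^ 2 ≤ ‖betaRow w γ k‖ ^ 2 := by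
    rw [Complex.sq_norm, Complex.sq_norm, Complex.normSq_apply, Complex.normSq_apply, hre]
    nlinarith
  by_contra hlt
  have hlt : ‖betaRow w γ k‖ < ‖betaRow w γ k₀‖ := lt_of_not_ge hlt
  have h0 := norm_nonneg (betaRow w γ k)
  nlinarith [mul_pos (by linarith : 0 < ‖betaRow w γ k₀‖ - ‖betaRow w γ k‖)
    (by linarith : 0 < ‖betaRow w γ k₀‖ + ‖betaRow w γ k‖)]

end Summit.AnomalousDissipation.SoloBlind.TailSeedGlue
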